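import Summits.QuantumAdvantage.QuantumAdvantage.Theorems.HintDialLevels

/-!
# HintDialAutomaton — module 3/10 of the HintDial THEOREMS package (cell decomp-qadv, lens-3 generation 6)

§4a: the `MOD₃` automaton (nodes, unipotent `N_w`, back-substitution), coordinates / edge literals, the generic separated linear-key Maiorana–McFarland table `blTable` and its Walsh transform.

Provenance: split of the farm-checked single file `HintDialTheorems.lean` (HOME/decomp-qadv-lens-3/g6/tree/; rc 0 · no proof holes ·
axioms ⊆ {propext, Classical.choice, Quot.sound}); mathematical record: HOME/decomp-qadv-lens-3/g6/NODE-g6.md.  Modules in order: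
HintDialDuality → HintDialLevels → HintDialAutomaton → HintDialLeakLaw → HintDialPlanting → HintDialClosure → HintDialTable → HintDialLowDegree → HintDialAnfLadder → HintDialCovariance (each imports its predecessor).  Namespace `Summit.QuantumAdvantage.QuantumAdvantage.Theorems.HintDial`.
-/

set_option linter.dupNamespace false

noncomputable section

namespace Summit.QuantumAdvantage.QuantumAdvantage.Theorems.HintDial

open Finset
open Literature.Computability.Complexity
open Literature.Computability.QuantumComplexity
open Literature.Computability.MetaComplexity
open _root_.Computability (encodeNat)
/-! ## §4 The hint-free dual bit is `MOD₃`-hard for `AC⁰[⊕]`: a unipotent (automaton) Maiorana–McFarland family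

Fix `m` and `w ∈ {0,1}^m`.  NODES `(r,s)`: `r ≤ m` a layer, `s ∈ ℤ/3` a counter state; `k = 3(m+1)` nodes with coordinates
`nd (r,s) : Fin k`.  The unipotent map `N_w` on `𝔽₂^{nodes}`: `(N_w z)(0,s) = z(0,s)`, `(N_w z)(r+1,s) = z(r+1,s) ⊕ z(r,s+w_r)`
— an upper-triangular matrix whose off-diagonal entries are the LITERALS `w_r`, `¬w_r`.  The (quadratic) cubic table on
`n = 2k` variables `F_w(x′,x″) = ⟨x′, N_w x″ ⊕ e_{a₀}⟩ ⊕ x″_{b₀}` (`a₀ = (0,0)`, `b₀ = (m,0)`) is a Maiorana–McFarland bent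
function all of whose table entries are literals of `w` (so `w ↦ code(instance)` is a projection); its dual is
`F̃_w(y′,y″) = q_{b₀} ⊕ ⟨q, y″⟩`, `q = N_w⁻¹(y′ ⊕ e_{a₀})` (`W_Fw`, `eval_G0`), a quadratic table `G0 w` whose entries are the
entries of `N_w⁻¹` (path parities of the layered graph — of UNBOUNDED degree in `w`) and whose constant, THE DUAL BIT, is
`F̃_w(0) = (N_w⁻¹ e_{a₀})_{b₀} = [#{r : w_r = 1} ≡ 0 (mod 3)]` (`G0_const`: back-substitution runs the mod-3 counter).  The
instance `inst w = ⟨2k, F_w, (const := 1, table := 0)⟩` therefore lies in `HintSlice 3` (indeed in every level `≥ 3`: the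
dual has no cubic part) on the YES side iff `MOD₃(w) = 0`; a separating `AC⁰[⊕]` family composed with the literal
projection would decide `MOD₃` — contradicting Smolensky's theorem (`Smolensky1987_modq_not_mem_AC0Mod_holds`, PROVED in the
tree). -/

namespace Automaton

open CubicForm (bit)
open DerivativeWalsh (W)
open BuzetChailloux (bxor zeroVec)

variable {m : ℕ}

/-- Nodes: (layer `r ≤ m`, counter state `s`). Layer `0` is the END of the run, layer `m` its START. -/
abbrev Nd (m : ℕ) : Type := Fin (m + 1) × Fin 3

/-- Number of nodes `k = 3(m+1)`; the instance has `n = k + k` variables. -/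
abbrev kk (m : ℕ) : ℕ := (m + 1) * 3

/-- node `≃` coordinate. -/
def nd : Nd m ≃ Fin (kk m) := finProdFinEquiv

/-- Node-indexed Boolean vectors. -/
abbrev NV (m : ℕ) : Type := Fin (m + 1) → Fin 3 → Bool

/-- The counter increment read at layer transition `r`. -/
def wF (w : Fin m → Bool) (r : Fin m) : Fin 3 := if w r = true then 1 else 0

/-- `N_w · z`. -/
def nmul (w : Fin m → Bool) (z : NV m) : NV m := fun r s =>
  Fin.cases (motive := fun _ => Bool) (z 0 s) (fun r' => xor (z r'.succ s) (z r'.castSucc (s + wF w r'))) r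

/-- `N_w⁻¹ · c`, by back-substitution upward from layer `0`. -/
def nsolve (w : Fin m → Bool) (c : NV m) : NV m :=
  Fin.induction (motive := fun _ => Fin 3 → Bool) (c 0) (fun r' ih => fun s => xor (c r'.succ s) (ih (s + wF w r')))

variable (w : Fin m → Bool)

/-- HintDial helper `nmul_zero` (lens-3 g6 HintDial THEOREMS package; see the enclosing section docstring). -/
@[simp] theorem nmul_zero (z : NV m) (s : Fin 3) : nmul w z 0 s = z 0 s := by
  simp [nmul]

/-- HintDial helper `nmul_succ` (lens-3 g6 HintDial THEOREMS package; see the enclosing section docstring). -/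
@[simp] theorem nmul_succ (z : NV m) (r : Fin m) (s : Fin 3) :
    nmul w z r.succ s = xor (z r.succ s) (z r.castSucc (s + wF w r)) := by
  simp [nmul]

/-- HintDial helper `nsolve_zero` (lens-3 g6 HintDial THEOREMS package; see the enclosing section docstring). -/
@[simp] theorem nsolve_zero (c : NV m) (s : Fin 3) : nsolve w c 0 s = c 0 s := by
  simp [nsolve]

/-- HintDial helper `nsolve_succ` (lens-3 g6 HintDial THEOREMS package; see the enclosing section docstring). -/
@[simp] theorem nsolve_succ (c : NV m) (r : Fin m) (s : Fin 3) :
    nsolve w c r.succ s = xor (c r.succ s) (nsolve w c r.castSucc (s + wF w r)) := by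
  simp [nsolve]

/-- HintDial helper `xor_xor_cancel` (lens-3 g6 HintDial THEOREMS package; see the enclosing section docstring). -/
theorem xor_xor_cancel (a b : Bool) : xor (xor a b) b = a := by cases a <;> cases b <;> rfl

/-- HintDial helper `nmul_nsolve` (lens-3 g6 HintDial THEOREMS package; see the enclosing section docstring). -/
theorem nmul_nsolve (c : NV m) : nmul w (nsolve w c) = c := by
  funext r s
  induction r using Fin.cases with
  | zero => simp
  | succ r' => rw [nmul_succ, nsolve_succ, xor_xor_cancel]

/-- HintDial helper `nsolve_nmul` (lens-3 g6 HintDial THEOREMS package; see the enclosing section docstring). -/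
theorem nsolve_nmul (z : NV m) : nsolve w (nmul w z) = z := by
  funext r
  induction r using Fin.induction with
  | zero => funext s; simp
  | succ r' ih => funext s; rw [nsolve_succ, nmul_succ, ih, xor_xor_cancel]

/-- HintDial helper `nmul_injective` (lens-3 g6 HintDial THEOREMS package; see the enclosing section docstring). -/
theorem nmul_injective : Function.Injective (nmul w) := fun z z' h => by
  rw [← nsolve_nmul w z, h, nsolve_nmul]

/-- Indicator vector of a node. -/
def single (a : Nd m) : NV m := fun r s => decide ((r, s) = a)

/-- HintDial helper `sum_bit_decide_eq_mul` (lens-3 g6 HintDial THEOREMS package; see the enclosing section docstring). -/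
theorem sum_bit_decide_eq_mul {ι : Type*} [Fintype ι] [DecidableEq ι] (a : ι) (f : ι → ZMod 2) :
    ∑ b, bit (decide (a = b)) * f b = f a := by
  simp_rw [bit_decide, ite_mul, one_mul, zero_mul]
  rw [Finset.sum_ite_eq]; simp

/-- HintDial helper `sum_bit_decide_eq_mul'` (lens-3 g6 HintDial THEOREMS package; see the enclosing section docstring). -/
theorem sum_bit_decide_eq_mul' {ι : Type*} [Fintype ι] [DecidableEq ι] (a : ι) (f : ι → ZMod 2) :
    ∑ b, bit (decide (b = a)) * f b = f a := by
  simp_rw [bit_decide, ite_mul, one_mul, zero_mul]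
  rw [Finset.sum_ite_eq']; simp

/-- HintDial helper `sum_mul_bit_decide_eq` (lens-3 g6 HintDial THEOREMS package; see the enclosing section docstring). -/
theorem sum_mul_bit_decide_eq {ι : Type*} [Fintype ι] [DecidableEq ι] (a : ι) (f : ι → ZMod 2) :
    ∑ b, f b * bit (decide (b = a)) = f a := by
  simp_rw [bit_decide, mul_ite, mul_one, mul_zero]
  rw [Finset.sum_ite_eq']; simp

/-- HintDial helper `sum_mul_bit_decide_eq_left` (lens-3 g6 HintDial THEOREMS package; see the enclosing section docstring). -/
theorem sum_mul_bit_decide_eq_left {ι : Type*} [Fintype ι] [DecidableEq ι] (a : ι) (f : ι → ZMod 2) :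
    ∑ b, f b * bit (decide (a = b)) = f a := by
  simp_rw [bit_decide, mul_ite, mul_one, mul_zero]
  rw [Finset.sum_ite_eq]; simp

/-- LINEARITY of back-substitution: expansion of `N_w⁻¹ c` along the node basis, in `𝔽₂`. -/
theorem bit_nsolve_expand (c : NV m) (r : Fin (m + 1)) (s : Fin 3) :
    bit (nsolve w c r s) = ∑ a : Nd m, bit (c a.1 a.2) * bit (nsolve w (single a) r s) := by
  induction r using Fin.induction generalizing s with
  | zero =>
    simp only [nsolve_zero, single]
    rw [sum_mul_bit_decide_eq_left]
  | succ r' ih =>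
    rw [nsolve_succ, bit_xor, ih]
    simp only [nsolve_succ, bit_xor, mul_add, sum_add_distrib]
    congr 1
    simp only [single]
    rw [sum_mul_bit_decide_eq_left]

/-- Number of ones among `w₀ … w_{r-1}` (recursively through the layers). -/
def cnt : Fin (m + 1) → ℕ :=
  Fin.induction (motive := fun _ => ℕ) 0 (fun r ih => ih + (if w r = true then 1 else 0))

/-- HintDial helper `cnt_zero` (lens-3 g6 HintDial THEOREMS package; see the enclosing section docstring). -/
@[simp] theorem cnt_zero : cnt w 0 = 0 := by simp [cnt]

/-- HintDial helper `cnt_succ` (lens-3 g6 HintDial THEOREMS package; see the enclosing section docstring). -/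
@[simp] theorem cnt_succ (r : Fin m) : cnt w r.succ = cnt w r.castSucc + (if w r = true then 1 else 0) := by
  simp [cnt]

/-- HintDial helper `cnt_eq_sum` (lens-3 g6 HintDial THEOREMS package; see the enclosing section docstring). -/
theorem cnt_eq_sum (r : Fin (m + 1)) :
    cnt w r = ∑ t : Fin m, if (t : ℕ) < (r : ℕ) then (if w t = true then 1 else 0) else 0 := by
  induction r using Fin.induction with
  | zero => simp
  | succ r' ih =>
    rw [cnt_succ, ih]
    have e : ∀ t : Fin m, (if (t : ℕ) < ((r'.succ : Fin (m + 1)) : ℕ) then (if w t = true then 1 else 0) else 0)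
        = (if (t : ℕ) < ((r'.castSucc : Fin (m + 1)) : ℕ) then (if w t = true then 1 else 0) else 0)
          + (if t = r' then (if w t = true then 1 else 0) else 0) := by
      intro t
      simp only [Fin.val_succ, Fin.val_castSucc]
      by_cases h2 : t = r'
      · subst h2
        rw [if_pos (Nat.lt_succ_self _), if_neg (lt_irrefl _), if_pos rfl, zero_add]
      · have ht : (t : ℕ) ≠ r' := fun h => h2 (Fin.ext h)
        rw [if_neg h2, add_zero]
        by_cases h3 : (t : ℕ) < r'
        · rw [if_pos h3, if_pos (by omega)]
        · rw [if_neg h3, if_neg (by omega)]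
    rw [Finset.sum_congr rfl fun t _ => e t, sum_add_distrib, Finset.sum_ite_eq' univ r', if_pos (mem_univ _)]

/-- HintDial helper `cnt_last` (lens-3 g6 HintDial THEOREMS package; see the enclosing section docstring). -/
theorem cnt_last : cnt w (Fin.last m) = GateFn.numOnes w := by
  rw [cnt_eq_sum, GateFn.numOnes, Finset.card_filter]
  refine sum_congr rfl fun t _ => ?_
  rw [if_pos (by simp [t.isLt])]

/-- ★ THE RUN OF THE COUNTER, by back-substitution: `(N_w⁻¹ e_{(0,0)})(r,s) = [s + #ones(w_{<r}) ≡ 0 (mod 3)]`. -/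
theorem nsolve_single_origin (r : Fin (m + 1)) (s : Fin 3) :
    nsolve w (single ((0 : Fin (m + 1)), (0 : Fin 3))) r s = decide (((s : ℕ) + cnt w r) % 3 = 0) := by
  induction r using Fin.induction generalizing s with
  | zero =>
    rw [nsolve_zero, cnt_zero]
    simp only [single, Prod.mk.injEq, true_and, add_zero]
    have hs := s.isLt
    by_cases h : s = 0
    · subst h; rfl
    · rw [decide_eq_false h, decide_eq_false]
      intro h'
      exact h (Fin.ext (by rw [Fin.val_zero]; omega))
  | succ r' ih =>
    rw [nsolve_succ, ih, cnt_succ]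
    have h0 : single ((0 : Fin (m + 1)), (0 : Fin 3)) r'.succ s = false := by
      simp [single, Fin.succ_ne_zero]
    rw [h0, Bool.false_xor]
    have hs := s.isLt
    cases hw : w r'
    · simp only [wF, hw, Bool.false_eq_true, ↓reduceIte, add_zero]
    · simp only [wF, hw, ↓reduceIte, Fin.val_add, Fin.val_one]
      congr 1; simp only [eq_iff_iff]; omega

/-- ★ THE DUAL BIT of the family is `MOD₃(w)`. -/
theorem nsolve_single_origin_last :
    nsolve w (single ((0 : Fin (m + 1)), (0 : Fin 3))) (Fin.last m) 0 = decide (GateFn.numOnes w % 3 = 0) := by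
  rw [nsolve_single_origin, cnt_last]; simp

/-! ### Coordinates, the edge literals, the two tables -/

/-- coordinates `→` node vectors. -/
def toNV (x : Fin (kk m) → Bool) : NV m := fun r s => x (nd (r, s))
/-- node vectors `→` coordinates. -/
def ofNV (z : NV m) : Fin (kk m) → Bool := fun i => z (nd.symm i).1 (nd.symm i).2

/-- HintDial helper `toNV_ofNV` (lens-3 g6 HintDial THEOREMS package; see the enclosing section docstring). -/
@[simp] theorem toNV_ofNV (z : NV m) : toNV (ofNV z) = z := by
  funext r s; simp [toNV, ofNV]

/-- HintDial helper `ofNV_toNV` (lens-3 g6 HintDial THEOREMS package; see the enclosing section docstring). -/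
@[simp] theorem ofNV_toNV (x : Fin (kk m) → Bool) : ofNV (toNV x) = x := by
  funext i; simp [toNV, ofNV]

/-- `a₀` = node `(0,0)` (END of the run, state 0): the offset of the permutation `π_w`. -/
def a₀ : Fin (kk m) := nd (((0 : Fin (m + 1)), (0 : Fin 3)) : Nd m)
/-- `b₀` = node `(m,0)` (START): the linear term `h(x″) = x″_{b₀}` of `F_w`. -/
def b₀ : Fin (kk m) := nd ((Fin.last m, (0 : Fin 3)) : Nd m)

/-- `w` extended to `ℕ` (junk `false`). -/
def wN (t : ℕ) : Bool := if h : t < m then w ⟨t, h⟩ else false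

/-- EDGE LITERAL `E_w(a,b) = 1` iff `a = (r+1,s)` and `b = (r, s + w_r)`; as a function of `w` each entry is the constant
`0`, the literal `w_r`, or the literal `¬w_r`. -/
def edgeB (a b : Nd m) : Bool :=
  decide ((b.1 : ℕ) + 1 = (a.1 : ℕ)) && (if b.2 = a.2 then !(wN w b.1) else if b.2 = a.2 + 1 then wN w b.1 else false)

/-- HintDial helper `edgeB_zero` (lens-3 g6 HintDial THEOREMS package; see the enclosing section docstring). -/
theorem edgeB_zero (s : Fin 3) (b : Nd m) : edgeB w ((0 : Fin (m + 1)), s) b = false := by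
  simp [edgeB]

/-- HintDial helper `fin3_ne_add_one` (lens-3 g6 HintDial THEOREMS package; see the enclosing section docstring). -/
theorem fin3_ne_add_one (s : Fin 3) : s ≠ s + 1 := by
  intro h; have := congrArg Fin.val h; simp [Fin.val_add] at this; omega

/-- HintDial helper `edgeB_succ` (lens-3 g6 HintDial THEOREMS package; see the enclosing section docstring). -/
theorem edgeB_succ (r' : Fin m) (s : Fin 3) (b : Nd m) :
    edgeB w (r'.succ, s) b = decide (b = (r'.castSucc, s + wF w r')) := by
  obtain ⟨rb, sb⟩ := b
  by_cases hr : rb = r'.castSucc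
  · subst hr
    have hw : wN w ((r'.castSucc : Fin (m + 1)) : ℕ) = w r' := by simp [wN, r'.isLt, Fin.val_castSucc]
    have hd : decide (((r'.castSucc : Fin (m + 1)) : ℕ) + 1 = ((r'.succ : Fin (m + 1)) : ℕ)) = true := by simp
    simp only [edgeB, hd, Bool.true_and, hw, Prod.mk.injEq, true_and]
    cases hw' : w r'
    · simp only [wF, hw', Bool.not_false]
      by_cases h : sb = s
      · simp [h]
      · simp [h]
    · simp only [wF, hw', Bool.not_true, if_true]
      by_cases h : sb = s
      · subst h; simp [fin3_ne_add_one sb]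
      · simp [h]
  · have h1 : (rb : ℕ) ≠ (r' : ℕ) := fun h => hr (Fin.ext (by rw [Fin.val_castSucc]; exact h))
    have h2 : ¬ ((rb, sb) = (r'.castSucc, s + wF w r')) := fun h => hr (Prod.mk.inj h).1
    rw [decide_eq_false h2]
    have hd : decide ((rb : ℕ) + 1 = ((r'.succ : Fin (m + 1)) : ℕ)) = false := decide_eq_false (by rw [Fin.val_succ]; omega)
    rw [edgeB, hd, Bool.false_and]

/-- `Q_w = I + E_w` (the matrix of `N_w`, node level). -/
def qEnt (a b : Nd m) : Bool := xor (decide (a = b)) (edgeB w a b)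

section Generic

variable {k : ℕ}

/-- Inner-product parity `⟨u,v⟩ mod 2`. -/
def bd (u v : Fin k → Bool) : Bool := decide (Odd (univ.filter fun i => u i && v i).card)

/-- HintDial helper `signOf_bd` (lens-3 g6 HintDial THEOREMS package; see the enclosing section docstring). -/
theorem signOf_bd (u v : Fin k → Bool) : signOf (bd u v) = twist u v := by
  rw [bd, SgnForrMem.signOf_decide_odd, Simon.twist_eq_neg_one_pow]

/-- HintDial helper `bit_bd` (lens-3 g6 HintDial THEOREMS package; see the enclosing section docstring). -/
theorem bit_bd (u v : Fin k → Bool) : bit (bd u v) = ∑ i, bit (u i) * bit (v i) := by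
  rw [bd, bit_decide_odd, Finset.natCast_card_filter]
  refine sum_congr rfl fun i _ => ?_
  rw [← bit_eq_ite, bit_and]

/-- Indicator of a coordinate. -/
def sgl (a : Fin k) : Fin k → Bool := fun i => decide (i = a)

/-- HintDial helper `bd_sgl_left` (lens-3 g6 HintDial THEOREMS package; see the enclosing section docstring). -/
theorem bd_sgl_left (a : Fin k) (x : Fin k → Bool) : bd (sgl a) x = x a :=
  bit_injective (by rw [bit_bd]; simp only [sgl]; rw [sum_bit_decide_eq_mul'])

/-- HintDial helper `bd_sgl_right` (lens-3 g6 HintDial THEOREMS package; see the enclosing section docstring). -/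
theorem bd_sgl_right (x : Fin k → Bool) (a : Fin k) : bd x (sgl a) = x a :=
  bit_injective (by rw [bit_bd]; simp only [sgl]; rw [sum_mul_bit_decide_eq])

/-- HintDial helper `bd_bxor_right` (lens-3 g6 HintDial THEOREMS package; see the enclosing section docstring). -/
theorem bd_bxor_right (x p q : Fin k → Bool) : bd x (bxor p q) = xor (bd x p) (bd x q) :=
  bit_injective (by
    rw [bit_xor, bit_bd, bit_bd, bit_bd, ← sum_add_distrib]
    refine sum_congr rfl fun i _ => ?_
    rw [show bxor p q i = xor (p i) (q i) from rfl, bit_xor, mul_add])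

/-- Matrix × vector over `𝔽₂`. -/
def mv (M : Fin k → Fin k → Bool) (x : Fin k → Bool) : Fin k → Bool := fun a => bd (M a) x

/-- Block pattern of a TWO-SIDED table on `k + k` variables: linear part `α` on the first half, cross terms `M a b·x′_a x″_b`,
linear part `β` on the second half. -/
def MM (α : Fin k → Bool) (M : Fin k → Fin k → Bool) (β : Fin k → Bool) : Fin k ⊕ Fin k → Fin k ⊕ Fin k → Bool
  | .inl a, .inl a' => decide (a = a') && α a
  | .inl a, .inr b => M a b
  | .inr _, .inl _ => false
  | .inr b, .inr b' => decide (b = b') && β b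

/-- The two-sided table (all coefficients stored at positions `(i,i,l)`; constant `c`). -/
def blTable (k : ℕ) (c : Bool) (α : Fin k → Bool) (M : Fin k → Fin k → Bool) (β : Fin k → Bool) : CubicForm (k + k) :=
  ⟨c, fun i j l => decide (i = j) && MM α M β (finSumFinEquiv.symm i) (finSumFinEquiv.symm l)⟩

/-- HintDial helper `blTable_cube_eq_true` (lens-3 g6 HintDial THEOREMS package; see the enclosing section docstring). -/
theorem blTable_cube_eq_true {c : Bool} {α : Fin k → Bool} {M : Fin k → Fin k → Bool} {β : Fin k → Bool} {i j l : Fin (k + k)}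
    (h : (blTable k c α M β).cube i j l = true) : i = j := by
  simp only [blTable, Bool.and_eq_true, decide_eq_true_eq] at h; exact h.1

/-- HintDial helper `bit_decide_and` (lens-3 g6 HintDial THEOREMS package; see the enclosing section docstring). -/
theorem bit_decide_and (p : Prop) [Decidable p] (t : Bool) : bit (decide p && t) = if p then bit t else 0 := by
  by_cases h : p <;> simp [h, bit]

/-- Bit semantics of the two-sided table. -/
theorem bit_eval_blTable (c : Bool) (α : Fin k → Bool) (M : Fin k → Fin k → Bool) (β : Fin k → Bool) (x₁ x₂ : Fin k → Bool) :
    bit ((blTable k c α M β).eval (Fin.append x₁ x₂))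
      = bit c + ∑ a, bit (α a) * bit (x₁ a) + ∑ a, ∑ b, bit (M a b) * (bit (x₁ a) * bit (x₂ b)) + ∑ b, bit (β b) * bit (x₂ b) := by
  rw [eval_bit]
  set x := Fin.append x₁ x₂ with hx
  have hj : ∀ i l : Fin (k + k), ∑ j, bit ((blTable k c α M β).cube i j l) * (bit (x i) * bit (x j) * bit (x l))
      = bit (MM α M β (finSumFinEquiv.symm i) (finSumFinEquiv.symm l)) * (bit (x i) * bit (x l)) := by
    intro i l
    rw [Finset.sum_eq_single i]
    · simp only [blTable, decide_true, Bool.true_and, bit_mul_self]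
    · intro j _ hji
      simp only [blTable, decide_eq_false (Ne.symm hji), Bool.false_and]
      simp [bit]
    · simp
  have h1 : ∑ i, ∑ j, ∑ l, bit ((blTable k c α M β).cube i j l) * (bit (x i) * bit (x j) * bit (x l))
      = ∑ i : Fin (k + k), ∑ l : Fin (k + k), bit (MM α M β (finSumFinEquiv.symm i) (finSumFinEquiv.symm l)) * (bit (x i) * bit (x l)) :=
    sum_congr rfl fun i _ => by rw [sum_comm]; exact sum_congr rfl fun l _ => hj i l
  rw [h1, Fin.sum_univ_add]
  simp_rw [Fin.sum_univ_add, hx, finSumFinEquiv_symm_apply_castAdd, finSumFinEquiv_symm_apply_natAdd, Fin.append_left,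
    Fin.append_right, MM, bit_decide_and, ite_mul, zero_mul, Finset.sum_ite_eq, Finset.mem_univ, if_true, bit_mul_self]
  simp only [bit_false, zero_mul, sum_const_zero, zero_add, sum_add_distrib]
  rw [show (blTable k c α M β).const = c from rfl]
  ring

/-- Boolean semantics of the two-sided table. -/
theorem eval_blTable (c : Bool) (α : Fin k → Bool) (M : Fin k → Fin k → Bool) (β : Fin k → Bool) (x₁ x₂ : Fin k → Bool) :
    (blTable k c α M β).eval (Fin.append x₁ x₂) = xor (xor (xor c (bd α x₁)) (bd x₁ (mv M x₂))) (bd β x₂) := by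
  apply bit_injective
  rw [bit_eval_blTable, bit_xor, bit_xor, bit_xor, bit_bd, bit_bd, bit_bd]
  simp only [mv, bit_bd, mul_sum]
  have e : ∀ a b : Fin k, bit (M a b) * (bit (x₁ a) * bit (x₂ b)) = bit (x₁ a) * (bit (M a b) * bit (x₂ b)) := fun a b => by ring
  simp only [e]

end Generic

end Automaton

end Summit.QuantumAdvantage.QuantumAdvantage.Theorems.HintDial

end
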